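import Summits.AtomisticToContinuum.Crystallization.Theorems.FrustratedLawDichotomyAperiodicGapNoPairCut

/-!
# FrustratedLawDichotomy · crux `AperiodicFrustratedLawGap` (stmt-AtomisticToContinuum-27623) — the COUNTABLE generic cut
# (decomp-a2c, prover hand 2, structural share)

`aperiodicFrustratedLawGap_cut_iUnion`: a COUNTABLE family `K i` of Giry-measurable events, each invariant under re-rooting of rooted hard-core
configurations and each SETTLED (the crux holds for laws almost surely carried by `K i`), peels off the crux AT ONCE: the crux (route decl, by
name) is equivalent to its restriction to laws almost surely carried by `(⋃ i, K i)ᶜ`.  Proof: disjointify (`E 0 = (⋃ K i)ᶜ`,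
`E (i+1) = disjointed K i`), condition a putative counterexample on every piece of positive mass (each conditioned law stays in the frame,
`isPointStationaryLaw_restrict_of_hc_invariant`), get `(P Eᵢ)·e⋆ ≤ ∫_{Eᵢ} h` with strict inequality on a piece of positive mass, and sum
(`integral_iUnion`, `tsum_pos`).  With the no-pair classes `K_{w_i}` of `FrustratedLawDichotomyDoublingGap` over a countable set of offsets
(e.g. `t e_j`, `t ∈ ℕ`, `t ≥ 2`) this removes from the residual, modulo the floor of item 9229, every law charging configurations with ONE
forbidden offset among them — in particular all slab and rod laws (`aperiodicFrustratedLawGap_iff_offNoPair_iUnion`).  All `[folklore]`.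
-/

noncomputable section

namespace Summit.AtomisticToContinuum.Crystallization.Theorems.FrustratedLawDichotomyAperiodicGapFiniteCut

open MeasureTheory Metric Set Filter ProbabilityTheory TopologicalSpace
open scoped ENNReal Topology BigOperators
open Literature.MathematicalPhysics.StatisticalMechanics Literature.Probability.Process
open Summit.AtomisticToContinuum.Crystallization.Theorems.ChargedEnergyGapNegative (E3 eStar)
open Summit.AtomisticToContinuum.Crystallization.Theorems.FrustratedLawDichotomyFiniteClusterGap
  (ae_mem_of_sep card_mul_eStar_lt_interactionEnergy eStar_lt_integral_rootEnergy_of_ae_noPair)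

section CountableCut

variable {δ : ℝ} {P : Measure (Measure E3)}

/-- `e⋆ < 0`. [folklore] -/
private theorem eStar_neg₆ : eStar < 0 := by
  have h := card_mul_eStar_lt_interactionEnergy (N := 1) one_pos (x := fun _ => (0 : E3)) (fun i j _ => Subsingleton.elim i j)
  rw [interactionEnergy_of_subsingleton] at h
  simpa using h

/-- **The COUNTABLE generic cut.**  For Giry-measurable events `K i`, `i : ℕ`, each invariant under re-rooting of rooted hard-core
configurations and each settled (hypothesis: the crux verbatim with the extra hypothesis `∀ᵐ μ ∂P, μ ∈ K i`), the crux (by name) is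
equivalent to its restriction to laws almost surely carried by `(⋃ i, K i)ᶜ`. [folklore] -/
theorem aperiodicFrustratedLawGap_cut_iUnion (K : ℕ → Set (MeasureTheory.Measure (EuclideanSpace ℝ (Fin 3)))) (hK : ∀ i, MeasurableSet (K i))
    (hinvK : ∀ i, ∀ δ : ℝ, 0 < δ → ∀ μ : MeasureTheory.Measure (EuclideanSpace ℝ (Fin 3)), Literature.Probability.Process.IsRootedHardCore δ μ →
      ∀ p : EuclideanSpace ℝ (Fin 3), μ {p} ≠ 0 → (μ ∈ K i ↔ MeasureTheory.Measure.map (fun z : EuclideanSpace ℝ (Fin 3) => z - p) μ ∈ K i))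
    (hgapK : ∀ i : ℕ, ∀ δ : ℝ, 0 < δ → ∀ P : MeasureTheory.Measure (MeasureTheory.Measure (EuclideanSpace ℝ (Fin 3))), let Gy : ℝ → (N : ℕ) → (Fin N → EuclideanSpace ℝ (Fin 3)) → Fin N → Prop := fun η N y j => let d : ℝ := sInf ((fun z => dist z (y (j : Fin N))) '' (Set.range (y) \ {(y (j : Fin N))})); let T : Set (EuclideanSpace ℝ (Fin 3)) := {z : EuclideanSpace ℝ (Fin 3) | z ∈ Set.range (y) ∧ z ≠ (y (j : Fin N)) ∧ dist z (y (j : Fin N)) < 13 / 10 * d}; ∃ A : EuclideanSpace ℝ (Fin 3) →ₗᵢ[ℝ] EuclideanSpace ℝ (Fin 3), (∃ e : ↥T ≃ ↥Literature.Geometry.DiscreteGeometry.fccKissingPattern, ∀ t : ↥T, dist (d⁻¹ • ((t : EuclideanSpace ℝ (Fin 3)) - (y (j : Fin N)))) (A ((e t : ↥Literature.Geometry.DiscreteGeometry.fccKissingPattern) : EuclideanSpace ℝ (Fin 3))) ≤ η) ∨ (∃ e : ↥T ≃ ↥Literature.Geometry.DiscreteGeometry.hcpKissingPattern, ∀ t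 : ↥T, dist (d⁻¹ • ((t : EuclideanSpace ℝ (Fin 3)) - (y (j : Fin N)))) (A ((e t : ↥Literature.Geometry.DiscreteGeometry.hcpKissingPattern) : EuclideanSpace ℝ (Fin 3))) ≤ η); let TexBall : (N : ℕ) → (Fin N → EuclideanSpace ℝ (Fin 3)) → Fin N → ℝ → ℝ → ℝ → ℝ → Prop := fun N y i R R₇ R₈ R₉ => (∀ a b : Fin N, a ≠ b → (7 : ℝ) / 10 ≤ dist (y a) (y b)) ∧ (∀ j : Fin N, dist (y j) (y i) ≤ R → ¬ Gy (1 / 20) N (y) j) ∧ (∀ j : Fin N, dist (y j) (y i) ≤ R → ¬ ((∀ j' : Fin N, dist (y j') (y j) ≤ R₇ → ¬ Gy (1 / 20) N (y) j') ∧ (∀ z : EuclideanSpace ℝ (Fin 3), dist z (y j) ≤ R₇ → ∃ k : Fin N, dist z (y k) ≤ 1) ∧ (∀ j' : Fin N, dist (y j') (y j) ≤ R₇ → (let d : ℝ := sInf ((fun z => dist z (y j')) '' (Set.range (y) \ {(y j')})); ∀ k : Fin N, y k ≠ y j' → dist (y k) (y j') < 27 / 20 * d → 5 ≤ Nat.card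 {m : Fin N // y m ≠ y j' ∧ dist (y m) (y j') < 27 / 20 * d ∧ y m ≠ y k ∧ dist (y m) (y k) < 27 / 20 * d})))) ∧ (∀ j : Fin N, dist (y j) (y i) ≤ R → ∃ k : Fin N, dist (y k) (y j) ≤ R₈ ∧ Gy (1 / 8) N (y) k) ∧ (∀ j : Fin N, dist (y j) (y i) ≤ R → ¬ ((∀ j' : Fin N, dist (y j') (y j) ≤ R₉ → ¬ Gy (1 / 20) N (y) j') ∧ (Nat.card {j' : Fin N // dist (y j') (y j) ≤ R₉ ∧ ¬ Gy (1 / 8) N (y) j'} : ℝ) ≤ 1 / 2 * (Nat.card {j' : Fin N // dist (y j') (y j) ≤ R₉} : ℝ) ∧ (∀ j' : Fin N, dist (y j') (y j) ≤ R₉ → ¬ Gy (1 / 8) N (y) j' → ¬ (let d : ℝ := sInf ((fun z => dist z (y j')) '' (Set.range (y) \ {(y j')})); ∀ k : Fin N, y k ≠ y j' → dist (y k) (y j') < 27 / 20 * d → 5 ≤ Nat.card {m : Fin N // y m ≠ y j' ∧ dist (y m) (y j') < 27 / 20 * d ∧ y m ≠ y k ∧ dist (y m) (y k) < 27 / 20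 * d})))); let Appr : MeasureTheory.Measure (EuclideanSpace ℝ (Fin 3)) → ℝ → ℝ → ℝ → Prop := fun μ R₇ R₈ R₉ => ∀ q : EuclideanSpace ℝ (Fin 3), μ {q} ≠ 0 → ∀ R ε : ℝ, 0 < ε → ∃ (N : ℕ) (y : Fin N → EuclideanSpace ℝ (Fin 3)) (i : Fin N), TexBall N y i R R₇ R₈ R₉ ∧ (∀ p : EuclideanSpace ℝ (Fin 3), μ {p} ≠ 0 → dist p q ≤ R → ∃ k : Fin N, dist (y k - y i) (p - q) ≤ ε) ∧ (∀ k : Fin N, dist (y k) (y i) ≤ R → ∃ p : EuclideanSpace ℝ (Fin 3), μ {p} ≠ 0 ∧ dist (y k - y i) (p - q) ≤ ε); MeasureTheory.IsProbabilityMeasure P → (∀ᵐ μ ∂P, Literature.Probability.Process.IsRootedHardCore δ μ) → Literature.Probability.Process.IsPointStationaryLaw P → (∃ R₇ R₈ R₉ : ℝ, ∀ᵐ μ ∂P, Appr μ R₇ R₈ R₉) → (∀ᵐ μ ∂P, ∀ p : EuclideanSpace ℝ (Fin 3), μ {p} ≠ 0 → ∀ y : EuclideanSpace ℝ (Fin 3),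 (∀ q : EuclideanSpace ℝ (Fin 3), μ {q} ≠ 0 → q ≠ p → y ≠ q) → ∑' q : {q : EuclideanSpace ℝ (Fin 3) // μ {q} ≠ 0 ∧ q ≠ p}, Literature.MathematicalPhysics.StatisticalMechanics.lennardJones (dist p (q : EuclideanSpace ℝ (Fin 3))) ≤ ∑' q : {q : EuclideanSpace ℝ (Fin 3) // μ {q} ≠ 0 ∧ q ≠ p}, Literature.MathematicalPhysics.StatisticalMechanics.lennardJones (dist y (q : EuclideanSpace ℝ (Fin 3)))) → P {μ : MeasureTheory.Measure (EuclideanSpace ℝ (Fin 3)) | ∃ Q : Literature.MathematicalPhysics.StatisticalMechanics.PeriodicConfiguration 3, ∃ t : EuclideanSpace ℝ (Fin 3), {p : EuclideanSpace ℝ (Fin 3) | μ {p} ≠ 0} = (fun s => s + t) '' Q.points} = 0 → (∀ᵐ μ ∂P, μ ∈ K i) → (⨅ Q : Literature.MathematicalPhysics.StatisticalMechanics.PeriodicConfiguration 3, Q.energyPerParticle Literature.MathematicalPhysics.StatisticalMechanics.lennardJones) < (∫ μ, Literature.MathematicalPhysics.StatisticalMechanics.rootEnergy Literature.MathematicalPhysics.StatisticalMechanics.lennardJones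 μ ∂P)) :
    Summit.AtomisticToContinuum.Crystallization.Theses.FrustratedLawDichotomy.AperiodicFrustratedLawGap ↔
    (∀ δ : ℝ, 0 < δ → ∀ P : MeasureTheory.Measure (MeasureTheory.Measure (EuclideanSpace ℝ (Fin 3))), let Gy : ℝ → (N : ℕ) → (Fin N → EuclideanSpace ℝ (Fin 3)) → Fin N → Prop := fun η N y j => let d : ℝ := sInf ((fun z => dist z (y (j : Fin N))) '' (Set.range (y) \ {(y (j : Fin N))})); let T : Set (EuclideanSpace ℝ (Fin 3)) := {z : EuclideanSpace ℝ (Fin 3) | z ∈ Set.range (y) ∧ z ≠ (y (j : Fin N)) ∧ dist z (y (j : Fin N)) < 13 / 10 * d}; ∃ A : EuclideanSpace ℝ (Fin 3) →ₗᵢ[ℝ] EuclideanSpace ℝ (Fin 3), (∃ e : ↥T ≃ ↥Literature.Geometry.DiscreteGeometry.fccKissingPattern, ∀ t : ↥T, dist (d⁻¹ • ((t : EuclideanSpace ℝ (Fin 3)) - (y (j : Fin N)))) (A ((e t : ↥Literature.Geometry.DiscreteGeometry.fccKissingPattern) : EuclideanSpace ℝ (Fin 3))) ≤ η) ∨ (∃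 e : ↥T ≃ ↥Literature.Geometry.DiscreteGeometry.hcpKissingPattern, ∀ t : ↥T, dist (d⁻¹ • ((t : EuclideanSpace ℝ (Fin 3)) - (y (j : Fin N)))) (A ((e t : ↥Literature.Geometry.DiscreteGeometry.hcpKissingPattern) : EuclideanSpace ℝ (Fin 3))) ≤ η); let TexBall : (N : ℕ) → (Fin N → EuclideanSpace ℝ (Fin 3)) → Fin N → ℝ → ℝ → ℝ → ℝ → Prop := fun N y i R R₇ R₈ R₉ => (∀ a b : Fin N, a ≠ b → (7 : ℝ) / 10 ≤ dist (y a) (y b)) ∧ (∀ j : Fin N, dist (y j) (y i) ≤ R → ¬ Gy (1 / 20) N (y) j) ∧ (∀ j : Fin N, dist (y j) (y i) ≤ R → ¬ ((∀ j' : Fin N, dist (y j') (y j) ≤ R₇ → ¬ Gy (1 / 20) N (y) j') ∧ (∀ z : EuclideanSpace ℝ (Fin 3), dist z (y j) ≤ R₇ → ∃ k : Fin N, dist z (y k) ≤ 1) ∧ (∀ j' : Fin N, dist (y j') (y j) ≤ R₇ → (let d : ℝ := sInf ((fun z => dist z (y j')) '' (Set.range (y) \ {(y j')})); ∀ k : Fin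 N, y k ≠ y j' → dist (y k) (y j') < 27 / 20 * d → 5 ≤ Nat.card {m : Fin N // y m ≠ y j' ∧ dist (y m) (y j') < 27 / 20 * d ∧ y m ≠ y k ∧ dist (y m) (y k) < 27 / 20 * d})))) ∧ (∀ j : Fin N, dist (y j) (y i) ≤ R → ∃ k : Fin N, dist (y k) (y j) ≤ R₈ ∧ Gy (1 / 8) N (y) k) ∧ (∀ j : Fin N, dist (y j) (y i) ≤ R → ¬ ((∀ j' : Fin N, dist (y j') (y j) ≤ R₉ → ¬ Gy (1 / 20) N (y) j') ∧ (Nat.card {j' : Fin N // dist (y j') (y j) ≤ R₉ ∧ ¬ Gy (1 / 8) N (y) j'} : ℝ) ≤ 1 / 2 * (Nat.card {j' : Fin N // dist (y j') (y j) ≤ R₉} : ℝ) ∧ (∀ j' : Fin N, dist (y j') (y j) ≤ R₉ → ¬ Gy (1 / 8) N (y) j' → ¬ (let d : ℝ := sInf ((fun z => dist z (y j')) '' (Set.range (y) \ {(y j')})); ∀ k : Fin N, y k ≠ y j' → dist (y k) (y j') < 27 / 20 * d → 5 ≤ Nat.card {m : Fin N // y m ≠ y j' ∧ dist (y m) (y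 j') < 27 / 20 * d ∧ y m ≠ y k ∧ dist (y m) (y k) < 27 / 20 * d})))); let Appr : MeasureTheory.Measure (EuclideanSpace ℝ (Fin 3)) → ℝ → ℝ → ℝ → Prop := fun μ R₇ R₈ R₉ => ∀ q : EuclideanSpace ℝ (Fin 3), μ {q} ≠ 0 → ∀ R ε : ℝ, 0 < ε → ∃ (N : ℕ) (y : Fin N → EuclideanSpace ℝ (Fin 3)) (i : Fin N), TexBall N y i R R₇ R₈ R₉ ∧ (∀ p : EuclideanSpace ℝ (Fin 3), μ {p} ≠ 0 → dist p q ≤ R → ∃ k : Fin N, dist (y k - y i) (p - q) ≤ ε) ∧ (∀ k : Fin N, dist (y k) (y i) ≤ R → ∃ p : EuclideanSpace ℝ (Fin 3), μ {p} ≠ 0 ∧ dist (y k - y i) (p - q) ≤ ε); MeasureTheory.IsProbabilityMeasure P → (∀ᵐ μ ∂P, Literature.Probability.Process.IsRootedHardCore δ μ) → Literature.Probability.Process.IsPointStationaryLaw P → (∃ R₇ R₈ R₉ : ℝ, ∀ᵐ μ ∂P, Appr μ R₇ R₈ R₉) → (∀ᵐ μ ∂P, ∀ p : EuclideanSpace ℝ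 (Fin 3), μ {p} ≠ 0 → ∀ y : EuclideanSpace ℝ (Fin 3), (∀ q : EuclideanSpace ℝ (Fin 3), μ {q} ≠ 0 → q ≠ p → y ≠ q) → ∑' q : {q : EuclideanSpace ℝ (Fin 3) // μ {q} ≠ 0 ∧ q ≠ p}, Literature.MathematicalPhysics.StatisticalMechanics.lennardJones (dist p (q : EuclideanSpace ℝ (Fin 3))) ≤ ∑' q : {q : EuclideanSpace ℝ (Fin 3) // μ {q} ≠ 0 ∧ q ≠ p}, Literature.MathematicalPhysics.StatisticalMechanics.lennardJones (dist y (q : EuclideanSpace ℝ (Fin 3)))) → P {μ : MeasureTheory.Measure (EuclideanSpace ℝ (Fin 3)) | ∃ Q : Literature.MathematicalPhysics.StatisticalMechanics.PeriodicConfiguration 3, ∃ t : EuclideanSpace ℝ (Fin 3), {p : EuclideanSpace ℝ (Fin 3) | μ {p} ≠ 0} = (fun s => s + t) '' Q.points} = 0 → (∀ᵐ μ ∂P, μ ∈ (⋃ i, K i)ᶜ) → (⨅ Q : Literature.MathematicalPhysics.StatisticalMechanics.PeriodicConfiguration 3, Q.energyPerParticle Literature.MathematicalPhysics.StatisticalMechanics.lennardJones)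 < (∫ μ, Literature.MathematicalPhysics.StatisticalMechanics.rootEnergy Literature.MathematicalPhysics.StatisticalMechanics.lennardJones μ ∂P)) := by
  constructor
  · intro h δ hδ P
    have h' := h δ hδ P
    dsimp only at h' ⊢
    intro hP ha hb hd he h0 _
    exact h' hP ha hb hd he h0
  · intro h δ hδ P
    have h' := h δ hδ
    dsimp only at h' ⊢
    intro hP ha hb hd he h0
    by_cases hint : Integrable (fun μ : Measure E3 => rootEnergy lennardJones μ) P
    swap
    · rw [integral_undef hint]; exact eStar_neg₆
    -- the pieces: `E 0 = (⋃ K i)ᶜ`, `E (i+1) = disjointed K i`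
    set E : ℕ → Set (Measure E3) := fun i => Nat.casesOn i (⋃ i, K i)ᶜ (fun j => disjointed K j) with hE
    have hE0 : E 0 = (⋃ i, K i)ᶜ := rfl
    have hES : ∀ j, E (j + 1) = disjointed K j := fun j => rfl
    have hEm : ∀ i, MeasurableSet (E i) := by
      intro i; cases i with
      | zero => rw [hE0]; exact (MeasurableSet.iUnion hK).compl
      | succ j => rw [hES]; exact MeasurableSet.disjointed hK j
    have hEdisj : Pairwise (Function.onFun Disjoint E) := by
      intro i j hij
      cases i with
      | zero =>
        cases j with
        | zero => exact absurd rfl hij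
        | succ j' =>
          rw [Function.onFun, hE0, hES]
          exact Set.disjoint_left.2 fun μ hμ hμ' => hμ (Set.mem_iUnion.2 ⟨j', disjointed_subset K j' hμ'⟩)
      | succ i' =>
        cases j with
        | zero =>
          rw [Function.onFun, hE0, hES]
          exact Set.disjoint_left.2 fun μ hμ hμ' => hμ' (Set.mem_iUnion.2 ⟨i', disjointed_subset K i' hμ⟩)
        | succ j' =>
          rw [Function.onFun, hES, hES]
          exact disjoint_disjointed K (fun h => hij (by rw [h]))
    have hEcov : (⋃ i, E i) = Set.univ := by
      apply Set.eq_univ_of_forall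
      intro μ
      by_cases hμ : μ ∈ ⋃ i, K i
      · rw [← iUnion_disjointed] at hμ
        obtain ⟨j, hj⟩ := Set.mem_iUnion.1 hμ
        exact Set.mem_iUnion.2 ⟨j + 1, hj⟩
      · exact Set.mem_iUnion.2 ⟨0, hμ⟩
    -- invariance of the pieces on rooted hard-core configurations
    have hinvE : ∀ i, ∀ μ : Measure E3, IsRootedHardCore δ μ → ∀ p : E3, μ {p} ≠ 0 →
        (μ ∈ E i ↔ Measure.map (fun z : E3 => z - p) μ ∈ E i) := by
      intro i μ hμ p hp
      have hiff : ∀ j, μ ∈ K j ↔ Measure.map (fun z : E3 => z - p) μ ∈ K j := fun j => hinvK j δ hδ μ hμ p hp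
      cases i with
      | zero =>
        rw [hE0, Set.mem_compl_iff, Set.mem_compl_iff, Set.mem_iUnion, Set.mem_iUnion]
        exact not_congr (exists_congr hiff)
      | succ j =>
        rw [hES, disjointed_apply]
        simp only [Finset.sup_eq_iSup, Set.iSup_eq_iUnion, Set.mem_sdiff, Set.mem_iUnion, hiff]
    -- each piece: floor `(P Eᵢ)·e⋆ ≤ ∫_{Eᵢ} h`, strict when `P Eᵢ ≠ 0`
    have hframe : ∀ (L : Set (Measure E3)), MeasurableSet L →
        (∀ μ : Measure E3, IsRootedHardCore δ μ → ∀ p : E3, μ {p} ≠ 0 → (μ ∈ L ↔ Measure.map (fun z : E3 => z - p) μ ∈ L)) → P L ≠ 0 →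
        IsProbabilityMeasure ((P L)⁻¹ • P.restrict L) ∧
        (∀ᵐ μ ∂((P L)⁻¹ • P.restrict L), IsRootedHardCore δ μ) ∧
        IsPointStationaryLaw ((P L)⁻¹ • P.restrict L) ∧
        (∀ᵐ μ ∂((P L)⁻¹ • P.restrict L), μ ∈ L) ∧
        ((P L)⁻¹ • P.restrict L) {μ : Measure E3 | ∃ Q : PeriodicConfiguration 3, ∃ t : E3,
            {p : E3 | μ {p} ≠ 0} = (fun s => s + t) '' Q.points} = 0 := by
      intro L hL hinvL hL0
      refine ⟨isProbabilityMeasure_cond' hL0, Measure.ae_smul_measure (ae_restrict_of_ae ha) _,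
        (isPointStationaryLaw_restrict_of_hc_invariant hδ ha hb hL hinvL).smul _, Measure.ae_smul_measure (ae_restrict_mem hL) _, ?_⟩
      rw [Measure.smul_apply, smul_eq_mul]
      refine mul_eq_zero_of_right _ (le_antisymm ?_ bot_le)
      exact (Measure.le_iff'.1 Measure.restrict_le_self _).trans h0.le
    have hpiece : ∀ i, (P (E i)).toReal * eStar ≤ ∫ μ in E i, rootEnergy lennardJones μ ∂P ∧
        (P (E i) ≠ 0 → (P (E i)).toReal * eStar < ∫ μ in E i, rootEnergy lennardJones μ ∂P) := by
      intro i
      refine setIntegral_ge_of_cond (P := P) (K := E i) (f := fun μ => rootEnergy lennardJones μ) (c := eStar) (fun hE0' => ?_)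
      obtain ⟨hP', ha', hb', hK', h0'⟩ := hframe (E i) (hEm i) (hinvE i) hE0'
      cases i with
      | zero =>
        refine h' _ hP' ha' hb' ?_ (Measure.ae_smul_measure (ae_restrict_of_ae he) _) h0' hK'
        obtain ⟨R₇, R₈, R₉, hd'⟩ := hd
        exact ⟨R₇, R₈, R₉, Measure.ae_smul_measure (ae_restrict_of_ae hd') _⟩
      | succ j =>
        have hG := hgapK j δ hδ
        dsimp only at hG
        refine hG _ hP' ha' hb' ?_ (Measure.ae_smul_measure (ae_restrict_of_ae he) _) h0'
          (hK'.mono fun μ hμ => disjointed_subset K j hμ)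
        obtain ⟨R₇, R₈, R₉, hd'⟩ := hd
        exact ⟨R₇, R₈, R₉, Measure.ae_smul_measure (ae_restrict_of_ae hd') _⟩
    -- summation over the pieces
    have hsumI : HasSum (fun i => ∫ μ in E i, rootEnergy lennardJones μ ∂P) (∫ μ, rootEnergy lennardJones μ ∂P) := by
      have h := hasSum_integral_iUnion hEm hEdisj hint.integrableOn
      rwa [hEcov, Measure.restrict_univ] at h
    have hsumM : HasSum (fun i => (P (E i)).toReal) 1 := by
      have h1 : P (⋃ i, E i) = ∑' i, P (E i) := measure_iUnion hEdisj hEm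
      rw [hEcov, measure_univ] at h1
      have h2 : ∑' i, (P (E i)).toReal = 1 := by
        rw [← ENNReal.tsum_toReal_eq fun i => measure_ne_top P (E i), ← h1, ENNReal.toReal_one]
      rw [← h2]
      exact (ENNReal.summable_toReal (by rw [← h1]; exact ENNReal.one_ne_top)).hasSum
    -- a piece of positive mass exists
    have h1 : (1 : ℝ≥0∞) = ∑' i, P (E i) := by
      rw [← measure_iUnion hEdisj hEm, hEcov, measure_univ]
    obtain ⟨i₀, hi₀⟩ : ∃ i, P (E i) ≠ 0 := by
      by_contra hall
      push Not at hall
      have : (∑' i, P (E i)) = 0 := by simp [hall]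
      rw [← h1] at this
      exact one_ne_zero this
    -- conclude: termwise `P(Eᵢ)·e⋆ ≤ ∫_{Eᵢ} h`, strictly at `i₀`, summed
    have hlt := hasSum_lt (f := fun i => (P (E i)).toReal * eStar) (g := fun i => ∫ μ in E i, rootEnergy lennardJones μ ∂P)
      (fun i => (hpiece i).1) ((hpiece i₀).2 hi₀) (hsumM.mul_right eStar) hsumI
    change eStar < _
    linarith

end CountableCut

end Summit.AtomisticToContinuum.Crystallization.Theorems.FrustratedLawDichotomyAperiodicGapFiniteCut

end
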